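import Literature.NumberTheory.Automorphic.TwistedQuotientIntegralFunctions
import Literature.Algebra.Homology.GroupCohomologyRetract
import Mathlib.RepresentationTheory.Homological.GroupCohomology.LongExactSequence
import Mathlib.RingTheory.Ideal.Maps
import HarnessLib

/-!
# Reduction of the induced-type module modulo a stable submodule, and the Bockstein bound
# `ker(H^q(M̃) → H^q(M̃/n)) = n · H^q(M̃)`

Topic `NumberTheory/Automorphic`; namespace `Literature.NumberTheory.Automorphic.TwistedQuotient`.
Definitions with bodies and theorems; no named fact, no instance, no `sorry`.

For `ι : Γ → 𝒢`, a level `L ≤ 𝒢`, a representation `σ` of `L` on an `A`-module `N` and the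
induced-type `Γ`-representation `indFun ι L σ = {F : 𝒢 → N | F(g l) = σ(l)⁻¹ F(g)}` (left
translation; `TwistedQuotientIntegralFunctions` — the untwisted form of the integral functions
`M̃`, there `intFunIso`):

* `indFunReduce ι L σ W hW : indFun ι L σ ⟶ indFun ι L (σ.quotient W)` — reduction modulo a
  `σ`-stable submodule `W ≤ N`, `F ↦ (g ↦ F g mod W)`; it is SURJECTIVE (`indFunReduce_surjective`:
  lift along a set-theoretic section of `𝒢 → 𝒢 ⧸ L`);
* for `n : ℕ` acting injectively on `N` and `W = n N`: the short exact sequence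
  `0 → indFun σ —n→ indFun σ → indFun (σ mod n) → 0` (`indFunSES`, `indFunSES_shortExact`), whence,
  by the long exact sequence of group cohomology (Mathlib `groupCohomology.mapShortComplex₂_exact`),
  the **Bockstein bound**: a class of `H^q(Γ, indFun σ)` dying in `H^q(Γ, indFun (σ mod n))` is
  divisible by `n` (`exists_eq_nsmul_of_map_indFunMod_eq_zero`), and consequently **an
  endomorphism killing `H^q(Γ, indFun (σ mod n))`-images maps `H^q(Γ, indFun σ)` into
  `n · H^q(Γ, indFun σ)`** (`exists_eq_nsmul_of_comp_reduce`).

This is the passage "`T_v − 𝕋(T_v)` acts nilpotently on `H^i(X_K, ℳ_{ξ,K}/p^m)` … hence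
`(T − a)^N H^i(X_K, ℳ_{ξ,K}) ⊆ p^m H^i(X_K, ℳ_{ξ,K})`" in the proof of [Scholze2015, Thm. V.4.1].

## References

* P. Scholze, *On torsion in the cohomology of locally symmetric varieties*, Ann. of Math. 182
  (2015), §V.4, proof of Thm. V.4.1 (arXiv:1306.2070, p. 67). [Scholze2015]
* K. S. Brown, *Cohomology of Groups*, GTM 87, Ch. III §6 (long exact sequence; Bockstein). [folklore]
-/

noncomputable section

open CategoryTheory groupCohomology

universe u

namespace Literature.NumberTheory.Automorphic

namespace TwistedQuotient

variable {A : Type u} [CommRing A] {Γ 𝒢 : Type u} [Group Γ] [Group 𝒢] (ι : Γ →* 𝒢)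
  (L : Subgroup 𝒢) {N : Type u} [AddCommGroup N] [Module A N] (σ : Representation A L N)

/-! ### Reduction modulo a stable submodule -/

section Reduce

variable (W : Submodule A N) (hW : ∀ l : L, W ≤ W.comap (σ l))

/-- Unfolding lemma for the quotient representation: `σ̄(l) (x mod W) = σ(l) x mod W`. [folklore] -/
theorem quotient_apply_mk (l : L) (x : N) :
    σ.quotient W hW l (Submodule.Quotient.mk x) = Submodule.Quotient.mk (σ l x) :=
  rfl

/-- **Reduction `indFun σ → indFun (σ mod W)`**, `F ↦ (g ↦ F g mod W)`, a morphism of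
`Γ`-representations. [folklore] -/
def indFunReduce : indFun ι L σ ⟶ indFun ι L (σ.quotient W hW) :=
  Rep.ofHom
    ⟨{ toFun := fun F => ⟨fun g => Submodule.Quotient.mk (F.1 g), fun g l => by
          change Submodule.Quotient.mk (F.1 (g * l)) = σ.quotient W hW l⁻¹ (Submodule.Quotient.mk (F.1 g))
          rw [F.2 g l]
          rfl⟩
       map_add' := fun F F' => Subtype.ext (funext fun g => rfl)
       map_smul' := fun a F => Subtype.ext (funext fun g => rfl) },
      fun γ => LinearMap.ext fun F => Subtype.ext (funext fun g => rfl)⟩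

/-- Unfolding lemma for `indFunReduce`. [folklore] -/
@[simp]
theorem indFunReduce_hom_apply_val (F : indFun ι L σ) (g : 𝒢) :
    ((indFunReduce ι L σ W hW).hom F).1 g = Submodule.Quotient.mk (F.1 g) :=
  rfl

/-- **`indFunReduce` is surjective**: lift `F̄` by `F(g) = σ(l_g)⁻¹ · lift(F̄(s(gL)))`, where `s`
is a set-theoretic section of `𝒢 → 𝒢 ⧸ L` and `g = s(gL) l_g`. [folklore] -/
theorem indFunReduce_surjective : Function.Surjective (indFunReduce ι L σ W hW).hom := by
  classical
  intro Fb
  -- a section of `𝒢 → 𝒢 ⧸ L` and the resulting `L`-coordinate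
  let s : 𝒢 → 𝒢 := fun g => ((g : 𝒢 ⧸ L).out : 𝒢)
  have hs : ∀ g : 𝒢, (s g)⁻¹ * g ∈ L := fun g =>
    QuotientGroup.eq.1 (QuotientGroup.out_eq' (g : 𝒢 ⧸ L))
  have hsl : ∀ (g : 𝒢) (l : L), s (g * l) = s g := fun g l => by
    change (((g * l : 𝒢) : 𝒢 ⧸ L).out : 𝒢) = ((g : 𝒢 ⧸ L).out : 𝒢)
    rw [QuotientGroup.mk_mul_of_mem g l.2]
  let lc : 𝒢 → L := fun g => ⟨(s g)⁻¹ * g, hs g⟩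
  have hlc : ∀ (g : 𝒢) (l : L), lc (g * l) = lc g * l := fun g l =>
    Subtype.ext (by
      change (s (g * l))⁻¹ * (g * l) = (s g)⁻¹ * g * l
      rw [hsl, mul_assoc])
  have hslc : ∀ g : 𝒢, s g * (lc g : 𝒢) = g := fun g => mul_inv_cancel_left (s g) g
  -- a set-theoretic lift `N ⧸ W → N`
  let lift : N ⧸ W → N := fun x => (Submodule.Quotient.mk_surjective W x).choose
  have hlift : ∀ x, Submodule.Quotient.mk (lift x) = x := fun x =>
    (Submodule.Quotient.mk_surjective W x).choose_spec
  -- the lift of `Fb`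
  refine ⟨⟨fun g => σ (lc g)⁻¹ (lift (Fb.1 (s g))), fun g l => ?_⟩, ?_⟩
  · change σ (lc (g * l))⁻¹ (lift (Fb.1 (s (g * l)))) = σ l⁻¹ (σ (lc g)⁻¹ (lift (Fb.1 (s g))))
    rw [hlc, hsl, mul_inv_rev, map_mul, Module.End.mul_apply]
  · refine Subtype.ext (funext fun g => ?_)
    rw [indFunReduce_hom_apply_val]
    change Submodule.Quotient.mk (σ (lc g)⁻¹ (lift (Fb.1 (s g)))) = Fb.1 g
    rw [← quotient_apply_mk L σ W hW, hlift, ← Fb.2 (s g) (lc g), hslc]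

/-- The kernel of `indFunReduce`: functions with values in `W`. [folklore] -/
theorem indFunReduce_hom_apply_eq_zero_iff (F : indFun ι L σ) :
    (indFunReduce ι L σ W hW).hom F = 0 ↔ ∀ g, F.1 g ∈ W := by
  constructor
  · intro h g
    have hg := congrArg (fun G : indFun ι L (σ.quotient W hW) => G.1 g) h
    exact (Submodule.Quotient.mk_eq_zero W).1 hg
  · intro h
    exact Subtype.ext (funext fun g => (Submodule.Quotient.mk_eq_zero W).2 (h g))

end Reduce

/-! ### Multiplication by `n` and the short exact sequence -/

section Bockstein

variable (n : ℕ)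

/-- `n N ≤ N` as the submodule `(n) • ⊤`. [folklore] -/
def nsmulSubmodule : Submodule A N :=
  (Ideal.span {(n : A)} : Ideal A) • ⊤

/-- Membership in `n N`. [folklore] -/
theorem mem_nsmulSubmodule_iff (x : N) : x ∈ nsmulSubmodule (A := A) (N := N) n ↔ ∃ y : N, (n : A) • y = x := by
  rw [nsmulSubmodule, Submodule.ideal_span_singleton_smul, Submodule.mem_smul_pointwise_iff_exists]
  simp

/-- `n N` is stable under `σ`. [folklore] -/
theorem nsmulSubmodule_le_comap (l : L) :
    nsmulSubmodule (A := A) (N := N) n ≤ (nsmulSubmodule (A := A) (N := N) n).comap (σ l) := by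
  intro x hx
  obtain ⟨y, rfl⟩ := (mem_nsmulSubmodule_iff n x).1 hx
  rw [Submodule.mem_comap, map_smul]
  exact (mem_nsmulSubmodule_iff n _).2 ⟨σ l y, rfl⟩

/-- The reduction `σ mod n` of `σ`. [folklore] -/
abbrev modRep : Representation A L (N ⧸ nsmulSubmodule (A := A) (N := N) n) :=
  σ.quotient (nsmulSubmodule n) (nsmulSubmodule_le_comap L σ n)

/-- The reduction map `indFun σ → indFun (σ mod n)`. [folklore] -/
abbrev indFunMod : indFun ι L σ ⟶ indFun ι L (modRep L σ n) :=
  indFunReduce ι L σ (nsmulSubmodule n) (nsmulSubmodule_le_comap L σ n)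

/-- `(n • 𝟙) F` evaluated: `n • F g`. [folklore] -/
theorem nsmul_id_hom_apply_val (F : indFun ι L σ) (g : 𝒢) :
    (((n • 𝟙 (indFun ι L σ) : indFun ι L σ ⟶ indFun ι L σ)).hom F).1 g = (n : A) • F.1 g := by
  rw [Rep.nsmul_hom, Rep.hom_id, Nat.cast_smul_eq_nsmul]
  rfl

/-- **The sequence `indFun σ —n→ indFun σ → indFun (σ mod n)`**. [folklore] -/
def indFunSES : ShortComplex (Rep A Γ) :=
  ShortComplex.mk (n • 𝟙 (indFun ι L σ)) (indFunMod ι L σ n) (by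
    refine Rep.hom_ext (Representation.IntertwiningMap.ext
      (LinearMap.ext fun F => Subtype.ext (funext fun g => ?_)))
    change Submodule.Quotient.mk (((n • 𝟙 (indFun ι L σ) : indFun ι L σ ⟶ indFun ι L σ).hom F).1 g) =
      (0 : 𝒢 → N ⧸ nsmulSubmodule (A := A) (N := N) n) g
    rw [nsmul_id_hom_apply_val]
    exact (Submodule.Quotient.mk_eq_zero _).2 ((mem_nsmulSubmodule_iff n _).2 ⟨F.1 g, rfl⟩))

variable (hn : Function.Injective fun x : N => (n : A) • x)

include hn in
/-- **`0 → indFun σ —n→ indFun σ → indFun (σ mod n) → 0` is short exact** when `n` acts injectively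
on `N` (e.g. `N` an `𝒪`-lattice, `n = p^s`). [cite: Scholze2015, §V.4 (proof of Thm. V.4.1)] -/
theorem indFunSES_shortExact : (indFunSES ι L σ n).ShortExact where
  exact := (forget₂ (Rep A Γ) (ModuleCat A)).reflects_exact_of_faithful _ <|
    (ShortComplex.moduleCat_exact_iff _).2 fun F hF => by
      -- `F` has values in `n N`: `F = n G` with `G` again of induced type
      have hF' : ∀ g, (F : indFun ι L σ).1 g ∈ nsmulSubmodule (A := A) (N := N) n :=
        (indFunReduce_hom_apply_eq_zero_iff ι L σ _ _ F).1 hF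
      choose G hG using fun g => (mem_nsmulSubmodule_iff n _).1 (hF' g)
      have hGmem : G ∈ indFunSubmodule L σ := by
        intro g l
        apply hn
        change (n : A) • G (g * l) = (n : A) • σ l⁻¹ (G g)
        rw [hG, ← map_smul, hG]
        exact F.2 g l
      refine ⟨⟨G, hGmem⟩, Subtype.ext (funext fun g => ?_)⟩
      exact (nsmul_id_hom_apply_val ι L σ n ⟨G, hGmem⟩ g).trans (hG g)
  mono_f := (Rep.mono_iff_injective _).2 fun F F' h => by
    refine Subtype.ext (funext fun g => hn ?_)
    have hg := congrArg (fun G : indFun ι L σ => G.1 g) h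
    exact ((nsmul_id_hom_apply_val ι L σ n F g).symm.trans hg).trans
      (nsmul_id_hom_apply_val ι L σ n F' g)
  epi_g := (Rep.epi_iff_surjective _).2 (indFunReduce_surjective ι L σ _ _)

/-! ### The Bockstein bound on cohomology -/

/-- `H^q` of multiplication by `n` is multiplication by `n`. [folklore] -/
theorem functor_map_nsmul_id (X : Rep A Γ) (q : ℕ) :
    (groupCohomology.functor A Γ q).map (n • 𝟙 X) = n • 𝟙 (groupCohomology X q) := by
  have h : (n • 𝟙 X : X ⟶ X) = ∑ _i : Fin n, 𝟙 X := by simp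
  rw [h, groupCohomology.functor_map, Literature.Algebra.Homology.map_id_sum]
  simp [groupCohomology.map_id]

include hn in
/-- **Bockstein**: a class of `H^q(Γ, indFun σ)` mapping to `0` in `H^q(Γ, indFun (σ mod n))` is
divisible by `n`. [cite: Scholze2015, §V.4 (proof of Thm. V.4.1)] -/
theorem exists_eq_nsmul_of_map_indFunMod_eq_zero (q : ℕ) (x : groupCohomology (indFun ι L σ) q)
    (hx : (groupCohomology.functor A Γ q).map (indFunMod ι L σ n) x = 0) :
    ∃ y : groupCohomology (indFun ι L σ) q, x = n • y := by
  have hex := groupCohomology.mapShortComplex₂_exact (indFunSES_shortExact ι L σ n hn) q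
  rw [ShortComplex.moduleCat_exact_iff] at hex
  obtain ⟨y, hy⟩ := hex x hx
  refine ⟨y, ?_⟩
  have hy' : ((groupCohomology.functor A Γ q).map (n • 𝟙 (indFun ι L σ))) y = x := hy
  rw [functor_map_nsmul_id] at hy'
  rw [← hy']
  rfl

include hn in
/-- **The nilpotence transfer**: if an endomorphism `Φ` of `H^q(Γ, indFun σ)` is compatible with an
endomorphism `Φ̄` of `H^q(Γ, indFun (σ mod n))` under reduction and `Φ̄` kills the image of the
reduction (e.g. `Φ = P(T)^{q+1}` for a Hecke operator `T`, by Hochschild–Serre nilpotence), then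
`Φ` maps `H^q(Γ, indFun σ)` into `n · H^q(Γ, indFun σ)`. [cite: Scholze2015, §V.4 (proof of Thm. V.4.1)] -/
theorem exists_eq_nsmul_of_comp_reduce (q : ℕ)
    (Φ : groupCohomology (indFun ι L σ) q →ₗ[A] groupCohomology (indFun ι L σ) q)
    (Φb : groupCohomology (indFun ι L (modRep L σ n)) q →ₗ[A]
      groupCohomology (indFun ι L (modRep L σ n)) q)
    (hcomm : ∀ x, (groupCohomology.functor A Γ q).map (indFunMod ι L σ n) (Φ x) =
      Φb ((groupCohomology.functor A Γ q).map (indFunMod ι L σ n) x))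
    (hΦb : ∀ x, Φb ((groupCohomology.functor A Γ q).map (indFunMod ι L σ n) x) = 0)
    (x : groupCohomology (indFun ι L σ) q) :
    ∃ y : groupCohomology (indFun ι L σ) q, Φ x = n • y :=
  exists_eq_nsmul_of_map_indFunMod_eq_zero ι L σ n hn q (Φ x) ((hcomm x).trans (hΦb x))

end Bockstein

end TwistedQuotient

end Literature.NumberTheory.Automorphic
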